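import Summits.ResolutionOfSingularities.ResolutionOfSingularities.Theorems.HilbertSamuelEliminationSigmaMaxModificationsCorridor3WLadderStrataRowCensus
import Summits.ResolutionOfSingularities.ResolutionOfSingularities.Theorems.HilbertSamuelEliminationSigmaMaxModificationsCorridor3WLadderStrataCentreCurveDominantClean
import Literature.AlgebraicGeometry.CossartJannsenSaito2020.DirectrixSemicontinuityProof
import HarnessLib

/-!
# [OURS · L1 W4.2] THE STRATA HALF `Wlow3CharStrataM p` OF `stub_Wlow3M_char` CLOSED MODULO PRINT, and the char row / the crux
# conjunct with the strata construction DISCHARGED — PROVED compositions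

Crux chain w42 (`SigmaMaxModifications`, stmt-ResolutionOfSingularities-18506; conjunct `SigmaMaxModificationsCorridor3`,
stmt-ResolutionOfSingularities-19249; line v8.2 `w_ladder_elim`, registered stub `stub_Wlow3M_char : ∀ p, p.Prime → Wlow3CharM p`), seat
res-L1-w42-stub-4 (gen 4): the STRATA HALF `Moving.Wlow3CharStrataM p` («no never-isolated infinite `ē ≤ 2` near chain from a maximal origin
in the (F1) regime»). OURS (cell res-hironaka, slot W4.2); NOT statements of H. Hironaka's manuscript [Hironaka2017] nor of
[CossartJannsenSaito2020]; AI-drafted, weaker than expert review. PURE COMPOSITIONS by name (no definition); every theorem is proved; the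
open content is exactly the PRINTED hypotheses listed (named facts of [CossartJannsenSaito2020] typed in `Literature/`, taken as binders).
Helper file `--supports stmt-ResolutionOfSingularities-19249`; credits nothing by itself.

THE LAST LOCAL KERNEL IS IN: res-D-pv-038's `strataCurveCentreDominantClean_of_thm_3_14 (h314) (h314p) (h36) :
StrataCurveCentreDominantClean p 3 (QNe (QCharRegime p)) (ē ≤ 2)` (p527476, (K-ctr-cv) modulo CJS Thm. 3.14 ×2 and Thm. 3.6). With this
seat's census `wlow3CharStrataM_of_printedFacts_nearFibre_curveKernel` (p527465: the bundle `LocalChainPrintedFacts` + F-61 + (K-ctr-cv)) and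
res-type-064's `CossartJannsenSaito2020_thm_3_6_of_thm_3_7` (F-65 from F-64, the inputs F-66/F-67 being theorems of the tree):

* §1 **`wlow3CharStrataM_of_printedFacts : LocalChainPrintedFacts → Thm314_nearFibre_subsingleton → CossartJannsenSaito2020_thm_3_6 →
  ∀ p, Wlow3CharStrataM p`** and **`wlow3CharStrataM_of_printedFacts' : LocalChainPrintedFacts → Thm314_nearFibre_subsingleton →
  CossartJannsenSaito2020_thm_3_7 → ∀ p, Wlow3CharStrataM p`** — THE STRATA HALF FROM EIGHT PRINTED NAMED FACTS, NO OURS HYPOTHESIS: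
  Cor. 6.37 (local form), Thm. 6.40 (unit-wise localised isolated form, F-04c), Thm. 3.14 (numerical form), Thm. 3.10 (4), Kollár 1.101
  (local-chain form; idle), Thm. 3.14 (point-centre locus form), Thm. 3.14 (near-fibre form, F-61), Thm. 3.7 (F-64) [or Thm. 3.6 (F-65)].
* §2 the char row: **`wlow3CharM_of_printedFacts_of_recognition`** / **`stub_Wlow3M_char_of_printedFacts_of_recognition`** —
  `∀ p, p.Prime → Wlow3CharM p` from NINE printed facts (the eight above and Cor. 6.37 (F1) global form `Corollary637_char`) and ONE OURS
  construction, stub-1's unit recognition `Seg.UnitRecognitionAtQM p (QCharRegime p)`; variant over the registered construction name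
  `UnitTowerExtractionLocQM p` (`wlow3CharM_of_printedFacts_of_extractionLoc`).
* §3 lead-1's crux census `Residue.sigmaMaxModificationsCorridor3_of_printed_of_rows` (`…ThirdDoorClosed`, skeleton `w_ladder` v6 shape) with its
  row `hS : ∀ p, p.Prime → Wlow3CharStrataM p` DISCHARGED: `Residue.sigmaMaxModificationsCorridor3_of_printed_of_four_rows`.

References: CJS LNM 2270 Thm. 3.6, Thm. 3.7, Thm. 3.10 (4), Thm. 3.14, Thm. 6.35, Cor. 6.37, Def. 6.38, Thm. 6.40, Rem. 6.29 (1), p. 104, p. 107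
[CossartJannsenSaito2020]; tree p527476 (res-D-pv-038), p527465 / p526497 / p524566 / p522551 (this seat), p525457 (res-type-064),
`…ThirdDoorClosed` (res-L1-w42-lead-1), `…LocalChainsLocalize` (res-type-053), `…LocalChainsTerminate` (res-D-pv-046).
-/

noncomputable section

-- plan-1/idea-2 module setting kept (namespace `…Corridor3.Moving` re-enters `…Corridor3`)
set_option linter.dupNamespace false

open CategoryTheory CategoryTheory.Limits AlgebraicGeometry TopologicalSpace Topology IsLocalRing
open Summit.ResolutionOfSingularities.ResolutionOfSingularities.Theorems.CampaignW42
open Literature.AlgebraicGeometry.Resolution Literature.RingTheory.HilbertSamuel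
open Literature.AlgebraicGeometry.CossartJannsenSaito2020
open Summit.ResolutionOfSingularities.ResolutionOfSingularities.Theses.HilbertSamuelElimination
open Summit.ResolutionOfSingularities.ResolutionOfSingularities.Theorems.SigmaMaxModificationsCorridor3

universe u

namespace Summit.ResolutionOfSingularities.ResolutionOfSingularities.Theorems.SigmaMaxModificationsCorridor3.Moving

/-! ## §1. The strata half from print alone -/

/-- **THE STRATA HALF `Wlow3CharStrataM p` CLOSED MODULO PRINT** — from the bundle `LocalChainPrintedFacts` (six printed named facts: Cor. 6.37
local form, Thm. 6.40 unit-wise localised isolated form, Thm. 3.14, Thm. 3.10 (4), Kollár 1.101 local-chain form, Thm. 3.14 point-centre locus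
form), the near-fibre form of Thm. 3.14 (`Thm314_nearFibre_subsingleton`, F-61) and Thm. 3.6 (`CossartJannsenSaito2020_thm_3_6`, F-65); NO OURS
hypothesis. Kernels: (b-fib) F-61 (p515327); (c-geo) card H (p513904 + `movingLineageLocalizesM_holds` + `localNearPointChainsTerminate_of_printedFacts`);
(c-reg) ⟸ (K-str) (p521289) ∧ (K-ctr-pt) (p524566, `ProjDir_projLine_holds`) ∧ (K-ctr-cv) (res-D-pv-038, p527476).
[cite: CossartJannsenSaito2020, Thm. 3.6, Thm. 3.14, Thm. 6.35, Cor. 6.37, Def. 6.38, Thm. 6.40, Rem. 6.29 (1), p. 107] -/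
theorem wlow3CharStrataM_of_printedFacts (hF : LocalChainPrintedFacts.{0}) (hFf : Thm314_nearFibre_subsingleton.{0})
    (h36 : CossartJannsenSaito2020_thm_3_6.{0}) (p : ℕ) : Wlow3CharStrataM p :=
  wlow3CharStrataM_of_printedFacts_nearFibre_curveKernel hF hFf
    (strataCurveCentreDominantClean_of_thm_3_14 hF.2.2.1 hF.thm314_point_locus h36)

/-- **THE STRATA HALF `Wlow3CharStrataM p` FROM PRINT, Thm. 3.6 replaced by Thm. 3.7 (F-64)** — res-type-064's
`CossartJannsenSaito2020_thm_3_6_of_thm_3_7` (the book's reduction of Thm. 3.6 to Thm. 3.7, its inputs Thm. 3.2 (3) and Matsumura 29.4 (ii)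
being theorems of the tree). [cite: CossartJannsenSaito2020, Thm. 3.6, Thm. 3.7, Thm. 3.14, Thm. 6.35] -/
theorem wlow3CharStrataM_of_printedFacts' (hF : LocalChainPrintedFacts.{0}) (hFf : Thm314_nearFibre_subsingleton.{0})
    (h37 : CossartJannsenSaito2020_thm_3_7.{0}) (p : ℕ) : Wlow3CharStrataM p :=
  wlow3CharStrataM_of_printedFacts hF hFf (CossartJannsenSaito2020_thm_3_6_of_thm_3_7 h37) p

/-- **The (F1)-regime strata row at level `3`, grade `ē ≤ 2`, in its `MaxOriginNoMovingNearChainAtQ` spelling, from print.**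
[cite: CossartJannsenSaito2020, Thm. 3.6, Thm. 3.14, Thm. 6.35, Rem. 6.29 (1)] -/
theorem maxOriginNoMovingNearChainAtQ_charRegime_notIso_of_printedFacts (hF : LocalChainPrintedFacts.{0})
    (hFf : Thm314_nearFibre_subsingleton.{0}) (h36 : CossartJannsenSaito2020_thm_3_6.{0}) (p : ℕ) :
    MaxOriginNoMovingNearChainAtQ.{0} p 3 (Helpers.QCharRegime p) fun s => s.geomDirDim ≤ 2 ∧ ¬ Iso 3 s :=
  wlow3CharStrataM_of_printedFacts hF hFf h36 p

/-! ## §2. The char row `stub_Wlow3M_char` modulo print and ONE construction (unit recognition) -/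

/-- **THE CHAR ROW `Wlow3CharM p` FROM NINE PRINTED NAMED FACTS AND ONE OURS CONSTRUCTION** — printed: the bundle `LocalChainPrintedFacts`,
`Corollary637_char` (Cor. 6.37, (F1) global form), `Thm314_nearFibre_subsingleton` (F-61), `CossartJannsenSaito2020_thm_3_6` (F-65); OURS
construction: stub-1's unit recognition `Seg.UnitRecognitionAtQM p (QCharRegime p)` (RECOGNITION CUT). Plugs: lead-1's
`wlow3CharM_of_printed_of_constructionsLoc` (model (b), `…ThirdDoorClosed`), stub-1's `unitTowerExtractionLocQM_of_recognition`, §1.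
CONDITIONAL — credits nothing. [cite: CossartJannsenSaito2020, Thm. 3.6, Thm. 3.10 (4), Thm. 3.14, Def. 6.34, Thm. 6.35, Cor. 6.37, Def. 6.38, Thm. 6.40, p. 107] -/
theorem wlow3CharM_of_printedFacts_of_recognition (hF : LocalChainPrintedFacts.{0}) (hC637 : Corollary637_char.{0})
    (hFf : Thm314_nearFibre_subsingleton.{0}) (h36 : CossartJannsenSaito2020_thm_3_6.{0}) {p : ℕ}
    (hrec : Seg.UnitRecognitionAtQM p (Helpers.QCharRegime p)) : Wlow3CharM.{0} p :=
  wlow3CharM_of_printed_of_constructionsLoc hF.2.1 hF.2.2.1 hF.2.2.2.1 hF.thm314_point_locus hC637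
    (unitTowerExtractionLocQM_of_recognition p hrec) (wlow3CharStrataM_of_printedFacts hF hFf h36 p)

/-- **The char row over the registered construction name `UnitTowerExtractionLocQM p`** (unit-wise localised extraction, stub-1, RULINGS
v3.10-1 (A)) and nine printed facts. [cite: CossartJannsenSaito2020, Thm. 3.6, Thm. 3.14, Cor. 6.37, Thm. 6.40, p. 107] -/
theorem wlow3CharM_of_printedFacts_of_extractionLoc (hF : LocalChainPrintedFacts.{0}) (hC637 : Corollary637_char.{0})
    (hFf : Thm314_nearFibre_subsingleton.{0}) (h36 : CossartJannsenSaito2020_thm_3_6.{0}) {p : ℕ}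
    (hext : UnitTowerExtractionLocQM p) : Wlow3CharM.{0} p :=
  wlow3CharM_of_printed_of_constructionsLoc hF.2.1 hF.2.2.1 hF.2.2.2.1 hF.thm314_point_locus hC637 hext
    (wlow3CharStrataM_of_printedFacts hF hFf h36 p)

/-- **The registered stub `stub_Wlow3M_char : ∀ p, p.Prime → Wlow3CharM p` MODULO PRINT AND UNIT RECOGNITION** — nine printed named facts and,
for every prime `p`, stub-1's `Seg.UnitRecognitionAtQM p (QCharRegime p)`; the strata half contributes NO hypothesis any more.
[cite: CossartJannsenSaito2020, Thm. 3.6, Thm. 3.14, Thm. 6.35, Cor. 6.37, Thm. 6.40] -/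
theorem stub_Wlow3M_char_of_printedFacts_of_recognition (hF : LocalChainPrintedFacts.{0}) (hC637 : Corollary637_char.{0})
    (hFf : Thm314_nearFibre_subsingleton.{0}) (h36 : CossartJannsenSaito2020_thm_3_6.{0})
    (hrec : ∀ p : ℕ, p.Prime → Seg.UnitRecognitionAtQM p (Helpers.QCharRegime p)) : ∀ p : ℕ, p.Prime → Wlow3CharM.{0} p :=
  fun p hp => wlow3CharM_of_printedFacts_of_recognition hF hC637 hFf h36 (hrec p hp)

end Summit.ResolutionOfSingularities.ResolutionOfSingularities.Theorems.SigmaMaxModificationsCorridor3.Moving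

/-! ## §3. The crux conjunct with the strata row discharged (skeleton `w_ladder` v6 census shape of `…ThirdDoorClosed`) -/

namespace Summit.ResolutionOfSingularities.ResolutionOfSingularities.Theorems.SigmaMaxModificationsCorridor3.Residue

open Summit.ResolutionOfSingularities.ResolutionOfSingularities.Theorems.SigmaMaxModificationsCorridor3.Moving

/-- **THE CRUX CONJUNCT `SigmaMaxModificationsCorridor3` FROM PRINT AND FOUR OURS ROWS** — lead-1's `sigmaMaxModificationsCorridor3_of_printed_of_rows`
(seven printed facts, five OURS rows) with the strata row `∀ p, p.Prime → Wlow3CharStrataM p` DISCHARGED by §1 (three more printed binders: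
the bundle `LocalChainPrintedFacts`, F-61, F-65). Remaining OURS rows: `UnitTowerExtractionQM`, `Wlow3TwoM`, `Wtop3PointedM`, `Wtop3NonpointedM`.
CONDITIONAL — credits nothing. [cite: CossartJannsenSaito2020, Thm. 1.2, Thm. 3.6, Thm. 3.10 (4), Thm. 3.14, Cor. 6.37, Thm. 6.40] -/
theorem sigmaMaxModificationsCorridor3_of_printed_of_four_rows
    (hNu : CossartJannsenSaito2020_nuElimination.{0}) (hSeq : CossartJannsenSaito2020SequencePermissible.{0})
    (h310 : CossartJannsenSaito2020_thm_3_10_4.{0}) (hK : KeyTheorem640_char_isolated.{0}) (hC : Corollary637_char.{0})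
    (h314 : CossartJannsenSaito2020_thm_3_14.{0}) (h314pt : Thm314_point_locus.{0}) (hF : LocalChainPrintedFacts.{0})
    (hFf : Thm314_nearFibre_subsingleton.{0}) (h36 : CossartJannsenSaito2020_thm_3_6.{0})
    (hU : ∀ p : ℕ, p.Prime → UnitTowerExtractionQM p) (hTwo : ∀ p : ℕ, p.Prime → Wlow3TwoM.{0} p)
    (hTopP : ∀ p : ℕ, p.Prime → Wtop3PointedM.{0} p) (hTopN : ∀ p : ℕ, p.Prime → Wtop3NonpointedM.{0} p) :
    SigmaMaxModificationsCorridor3 :=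
  sigmaMaxModificationsCorridor3_of_printed_of_rows hNu hSeq h310 hK hC h314 h314pt hU
    (fun p _ => wlow3CharStrataM_of_printedFacts hF hFf h36 p) hTwo hTopP hTopN

end Summit.ResolutionOfSingularities.ResolutionOfSingularities.Theorems.SigmaMaxModificationsCorridor3.Residue

end
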